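import Summits.BirchSwinnertonDyer.BirchSwinnertonDyer.Theses.UniversalToricDescent
import Summits.BirchSwinnertonDyer.BirchSwinnertonDyer.Theorems.UniversalToricDescentDefectTransportOfSigmaCongruence
import Summits.BirchSwinnertonDyer.BirchSwinnertonDyer.Theorems.UniversalToricDescentDefectTransportTwinTowerOnBadSet
import Summits.BirchSwinnertonDyer.BirchSwinnertonDyer.Theorems.UniversalToricDescentDefectTransportModThreePTStubOneSidedGlue
import Summits.BirchSwinnertonDyer.BirchSwinnertonDyer.Theorems.UniversalToricDescentDefectTransportModThreePTStubTwinStrictSurj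
import Summits.BirchSwinnertonDyer.BirchSwinnertonDyer.Theorems.UniversalToricDescentDefectTransportModThreePTStubTwinSignatureTorsion
import Summits.BirchSwinnertonDyer.BirchSwinnertonDyer.Theorems.UniversalToricDescentDefectTransportModThreePTStubTwinSigmaSurjOfCount
import Summits.BirchSwinnertonDyer.BirchSwinnertonDyer.Theorems.UniversalToricDescentDefectTransportModThreePTStubLocalH1Divisible
import Summits.BirchSwinnertonDyer.BirchSwinnertonDyer.Theorems.UniversalToricDescentDefectTransportModThreePTStubLocalTorsionCountAtTame
import Summits.BirchSwinnertonDyer.BirchSwinnertonDyer.Theorems.UniversalToricDescentDefectTransportModThreePTStubCountOfRelaxedImage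
import Summits.BirchSwinnertonDyer.BirchSwinnertonDyer.Theorems.UniversalToricDescentDefectTransportModThreePTStubRelaxedImageCount
import HarnessLib

/-!
# SKELETON v10 (line `sigmacongruence`, lead bsd-wall-utd-p1 g16–g19, 2026-08-29; v10 registered by g19) for the ONE-SIDED crux ♭T≤
# `DefectTransportModThreePT` = stmt-BirchSwinnertonDyer-23042 (R1-♭T≤, pen pss3x g6 16:22:57Z: last conjunct `n + m' = n' + m` ↦ `n' + m ≤ n + m'`):
# ♭T≤ = A ∧ B′≤, composition PROVED; B′≤ DERIVED from the TWO twin stubs TS1′, TS2′ through the LANDED one-sided glue G≤.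

History: v3 (g14, sha16 99186317c8a1fbf9) derived the two-sided B′ from FOUR twin stubs — F3 (conjugate transport), TS1 (GV
Prop. 2.1 at `𝔭′`), TS2 (GV Cor. 2.3 at the bad places), TS3 (no finite `Λ`-submodule of `X_{𝔭′}^S(E′)`) — through the landed
glue `defectTransport_algebraicHalf_lambda_of_wall_of_twinTowerOnBadSet`. g15 (GROWTH-ROAD-utdp1g15.md §2–§3, CERT
1cbeefc18eab6892) showed that TS3 is the reverse λ-inequality (H²-level, no consumer) and that the kernel's cross-squeeze needs
only `n' + m ≤ n + m'`; the pen RESTATED the crux one-sided (R1-♭T≤, sequenced). v4a: F3 and TS3 DELETED; TS1′/TS2′ = TS1/TS2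
WITHOUT the finiteness hypothesis at the conjugate prime `𝔭` (F3's only output); the one-sided glue G≤ is LANDED
(`Theorems/UniversalToricDescentDefectTransportModThreePTStubOneSidedGlue.lean`, `stub_oneSidedGlue` in this namespace: (M1) WITH
INDEX from (S′) alone p654846/p655405, Pontryagin `#X[3] = #(Sel/3Sel)`, Herbrand `3^λ·#X[3] = #Sel[3]`, λ-shift + corank additivity
from (Σ′) p654847 — no divisibility, no (N′)). v4 (this file) = v4a with the temporary stub G≤ replaced by that import: THREE stubs.

v5 (g17): STUB TS1′ `stub_twinStrictSurj` LANDED (p674266, growth road: E2b p669209 + local two-sided count p673330) — its `sorry`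
is replaced by the import `…StubTwinStrictSurj`; TWO stubs remain (A, TS2′).

v6/v7 (g17): TS2′ RESHAPED into TS2-COUNT + TS2-DIV + TS2-TORS + TS2-ASSEMBLY; TORS (p677052) and ASSEMBLY (p679520) landed. v8 (g18):
TS2-DIV LANDED (`…StubLocalH1Divisible`, width utd-p1-w2) — its `sorry` is replaced by that import; TWO stubs remain: A (research
item 27120) and TS2-COUNT `stub_twinSigmaCount` (the lead's). v9 (g18): TS2-COUNT RESHAPED along the RELAXED COUNT ROAD
(memo RELAXED-COUNT-ROAD-utdp1g18.md): R3 `stub_localTorsionCountAtTame` (local torsion count at `v`, delegable) + R1 `stub_relaxedImageCount` (layer engine: one relative Poitou–Tate count between Kummer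
structures of `E′_{K_n}[3^k]` relaxed above `3`, transported to the relaxed group `Y^{S∪v}`; the lead's) + R2 `stub_countOfRelaxedImage`
(`K_∞`-level assembly through the LANDED TS1′; delegable); TS2-COUNT is DERIVED from R3 + R1 + R2 (statement unchanged). FOUR sorries: A, R3, R1, R2.
v10 (g18 FINAL): R3 LANDED (width utd-p1-w2 g2, p689873 `…StubLocalTorsionCountAtTame`), R2 LANDED (width utd-p1-w2 g1, p686469
`…StubCountOfRelaxedImage`), R1 LANDED (lead g18, `…StubRelaxedImageCount`: the relaxed count road F3–F8, 16 helper files) — their `sorry`s are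
replaced by those imports. ONE sorry remains: A (`stub_sigmaCongruence`, research item stmt-BirchSwinnertonDyer-27120).

Stubs (every `sorry` below is a stub — TWO in v5 (A, TS2′); TS1′ is the landed theorem of the same name; the derived B′≤ and the composition have none):
* `stub_sigmaCongruence` (A, ANALYTIC, RESEARCH; = route item 27120 up to one inserted hypothesis) — unchanged (v1–v3).
* `stub_twinStrictSurj` (TS1′ = (S′)): GV Prop. 2.1 at the strict place `𝔭′` for the rank-free twin. Road: GROWTH ROAD (weak
  Leopoldt source growth LANDED p648146/p648827/p649013; local two-sided count at `𝔭′`; `Λ`-torsion-freeness of the local dual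
  from `cd₃ ≤ 1` + counts; `injective_of_weakLeopoldt_growth` p645087).
* `stub_twinSigmaSurj` (TS2′ = (Σ′)): GV Cor. 2.3 at a finitely decomposed tame place for the twin.
* `oneSidedTransport` (B′≤) — DERIVED from TS1′ + TS2′ + the landed glue `stub_oneSidedGlue` (bad set, `3` split, `μ(X_E) = 0` from the wall, residual transfer of
  finiteness to `E′`, `E′(K_∞)[3] = 0` from `ρ̄_{E,3}` onto).
* `DefectTransportModThreePT_of` — A → B′≤ → ♭T≤ BY NAME (`omega` on `λ′ + Σ′ ≤ λ + Σ` and A's `m + Σ = m′ + Σ′`).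

Crux of record: stmt-BirchSwinnertonDyer-23042 (UTD rev 71, the pen's STEP 2 restate of 26975; same decl name
`…Theses.UniversalToricDescent.DefectTransportModThreePT`, one-sided text). BSD is not proved by any of this.
-/


noncomputable section

open scoped Classical

set_option linter.dupNamespace false
set_option autoImplicit false

namespace Summit.BirchSwinnertonDyer.BirchSwinnertonDyer.Cruxes.DefectTransportModThreePT.SigmaCongruence

open PowerSeries WeierstrassCurve NumberField IsDedekindDomain Field Polynomial
  Literature.NumberTheory.EllipticCurves
  Literature.NumberTheory.EllipticCurves.ModularForms
  Literature.NumberTheory.EllipticCurves.Rank1Residual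
  Literature.NumberTheory.EllipticCurves.GreenbergSelmer
  Literature.NumberTheory.EllipticCurves.IwasawaAlgebra
  Literature.NumberTheory.GaloisRepresentations Literature.NumberTheory.GaloisCohomology
  Summit.BirchSwinnertonDyer.Rank1Residual Summit.BirchSwinnertonDyer.Rank1Residual.X11b
  Summit.BirchSwinnertonDyer.Rank1Residual.X11b.AcSelmer Summit.BirchSwinnertonDyer.Rank1Residual.X11b.Coinv
  Summit.BirchSwinnertonDyer.Rank1Residual.Iwasawa
  Summit.BirchSwinnertonDyer.BirchSwinnertonDyer.Theorems
  Summit.BirchSwinnertonDyer.BirchSwinnertonDyer.Theorems.SchneiderFree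
  Summit.BirchSwinnertonDyer.BirchSwinnertonDyer.Theorems.UniversalToricDescentDefectTransport
  Summit.BirchSwinnertonDyer.BirchSwinnertonDyer.Theorems.UniversalToricDescentNormProfile
  Summit.BirchSwinnertonDyer.BirchSwinnertonDyer.Theorems.UniversalToricDescentSigmaLocalImage
  Summit.BirchSwinnertonDyer.BirchSwinnertonDyer.Theorems.UniversalToricDescentSigmaLocalStabilizer
  Summit.BirchSwinnertonDyer.BirchSwinnertonDyer.Theorems.UniversalToricDescentSigmaCoinvariants
  Summit.BirchSwinnertonDyer.BirchSwinnertonDyer.Theorems.UniversalToricDescentAcDualMuZero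
  Summit.BirchSwinnertonDyer.BirchSwinnertonDyer.Theorems.UniversalToricDescentResidualSelmer
  Summit.BirchSwinnertonDyer.BirchSwinnertonDyer.Theorems.UniversalToricDescentSigmaPassage
  Summit.BirchSwinnertonDyer.BirchSwinnertonDyer.Theorems.UniversalToricDescentNoFiniteSubmodule
  Summit.BirchSwinnertonDyer.BirchSwinnertonDyer.Theorems.UniversalToricDescentSigmaFree

/-- STUB A (RESEARCH; the line's load-bearing statement): **the Σ-depleted congruence of the BDP frames.** For ♭T's binders
and a pair of frames `𝓛` (of `f_E`) and `𝓛′` (of `f_{E′}`): for the finite bad set `T = {v ∤ 3 : E_K or E′_K bad at v}` and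
its exact indices `c_v` (`κ(D_v) = 3^{c_v}ℤ₃`), there are exponents `e_v ≠ 0` with `v_3(e_v) = c_v` (the Frobenius of `v` in
`Γ` is `γ^{±e_v}`) and a unit `u ∈ R₀⟦T⟧` with `𝓛·∏_{v∈T}P_v(q_v⁻¹(1+T)^{e_v}) ≡ u·𝓛′·∏_{v∈T}P′_v(q_v⁻¹(1+T)^{e_v})`
coefficientwise `mod 𝔪_{R₀}`. Printed: the value at `T = 0` [Kriz–Li 2019, Thm. 1.16] (any reduction at `p`); the whole
statement for `p ∤ NN′` [LeiMullerXia2023, Thm. B / Cor. 3.8]; UNPRINTED at `27 ∣ N`. -/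
theorem stub_sigmaCongruence :
    ∀ (W : WeierstrassCurve ℚ) [W.IsElliptic] [W.IsGloballyMinimal] (W' : WeierstrassCurve ℚ) [W'.IsElliptic]
      [W'.IsGloballyMinimal] (N N' : ℕ) [NeZero N] [NeZero N'] (K : Type) [Field K] [NumberField K]
      (Dt : ModularParametrizationData W N) (Dt' : ModularParametrizationData W' N'),
      Additive.ClassO6 W 3 → W.HasSurjectiveModNGaloisRep 3 → W.analyticRank = 1 → W.conductorNorm ℤ = N →
      O6.ModPCongruent W' W 3 → ¬ Addv W' 3 → W'.conductorNorm ℤ = N' → IsImaginaryQuadratic K →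
      SatisfiesHeegnerHypothesis N K → SatisfiesHeegnerHypothesis N' K →
      ∀ (κ : ZpExtension K 3), κ.IsAnticyclotomic → ∀ (γ : absoluteGaloisGroup K) [Fact (κ.IsTopGenerator γ)]
      (𝔭 : HeightOneSpectrum (𝓞 K)), ((3 : ℕ) : 𝓞 K) ∈ 𝔭.asIdeal → 𝔭.asIdeal.ramificationIdx (𝓞 ℚ) = 1 →
      𝔭.asIdeal.inertiaDeg (𝓞 ℚ) = 1 → ∀ (𝔭' : HeightOneSpectrum (𝓞 K)), ((3 : ℕ) : 𝓞 K) ∈ 𝔭'.asIdeal → 𝔭' ≠ 𝔭 →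
      ∀ (ι' : PadicAlgCl 3 ≃+* ℂ), BranchInducesPrime 3 ι' 𝔭 →
      ∀ (ΩK : ℂ) (Ωp : ℂ_[3]) (L : UnrSeries 3), ΩK ≠ 0 → Ωp ≠ 0 → IsBDPLFunction ι' 𝔭 κ γ Dt.f ΩK Ωp L →
      ∀ (ΩK' : ℂ) (Ωp' : ℂ_[3]) (L' : UnrSeries 3), ΩK' ≠ 0 → Ωp' ≠ 0 → IsBDPLFunction ι' 𝔭 κ γ Dt'.f ΩK' Ωp' L' →
      ∀ (T : Finset (HeightOneSpectrum (𝓞 K))) (c : HeightOneSpectrum (𝓞 K) → ℕ),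
      (↑T = {v : HeightOneSpectrum (𝓞 K) | ((3 : ℕ) : 𝓞 K) ∉ v.asIdeal ∧
        (¬ (W.baseChange K).HasGoodReductionAt v ∨ ¬ (W'.baseChange K).HasGoodReductionAt v)}) →
      (∀ v ∈ T, (∃ d₀ : decomp (K := K) v, (κ (d₀ : absoluteGaloisGroup K)).toAdd = (3 : ℤ_[3]) ^ c v) ∧
        (∀ d : decomp (K := K) v, (3 : ℤ_[3]) ^ c v ∣ (κ (d : absoluteGaloisGroup K)).toAdd)) →
      ∃ (e : HeightOneSpectrum (𝓞 K) → ℤ_[3]) (u : UnrSeries 3), IsUnit u ∧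
        (∀ v ∈ T, e v ≠ 0 ∧ (e v).valuation = c v) ∧
        ∀ i : ℕ, ‖((PowerSeries.coeff i
          (L * PowerSeries.map (Halves.toUnr 3) (∏ v ∈ T, (Polynomial.aeval
              (PowerSeries.C ((Nat.card (IsLocalRing.ResidueField (v.adicCompletionIntegers K)) : ℤ_[3]).inv) *
                PowerSeries.binomialSeries ℤ_[3] (e v)) ((W.baseChange K).localPolynomialAt v) :
                  IwasawaAlgebra 3)) -
            u * (L' * PowerSeries.map (Halves.toUnr 3) (∏ v ∈ T, (Polynomial.aeval
              (PowerSeries.C ((Nat.card (IsLocalRing.ResidueField (v.adicCompletionIntegers K)) : ℤ_[3]).inv) *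
                PowerSeries.binomialSeries ℤ_[3] (e v)) ((W'.baseChange K).localPolynomialAt v) :
                  IwasawaAlgebra 3)))) :
          unrIntegers 3) : ℂ_[3])‖ < 1 := by
  sorry

/- v10 (g18 FINAL): the three v9 stubs R3 `stub_localTorsionCountAtTame` (width utd-p1-w2 g2, p689873), R1 `stub_relaxedImageCount`
(lead g18, `…StubRelaxedImageCount`) and R2 `stub_countOfRelaxedImage` (width utd-p1-w2 g1, p686469) are LANDED theorems of the same
names in this namespace (imported above); their statements were registered VERBATIM in v9 (sha16 1bb2faab747a10b8). ONE stub remains: A. -/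

/-- DERIVED TS2-COUNT (v9: no sorry of its own — from R3 `stub_localTorsionCountAtTame` and R1 `stub_relaxedImageCount` through R2 `stub_countOfRelaxedImage`;
v6 g17 statement unchanged — the Poitou–Tate CONTENT of TS2′, as a k-UNIFORM COUNT):
there is a constant `C` such that for every `k` and every finite set `Φ` of `3^k`-torsion `v`-signatures
(right-`ker κ`-invariant, left-`D_v`-equivariant `F : Γ_K → H¹(kerD κ v, E′_K[3^∞])`),
`#Sel_{𝔭′}^{S}(K_∞)[3^k] · #Φ ≤ C · #Sel_{𝔭′}^{S∪{v}}(K_∞)[3^k]`.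
[cite: GreenbergVatsal2000, §2 Prop. (2.1), Cor. (2.3) (pp. 23–25)] [cite: MilneADT2006, Ch. I, Thm. 4.10, Thm. 2.6] -/
theorem stub_twinSigmaCount :
    Summit.BirchSwinnertonDyer.BirchSwinnertonDyer.Theses.UniversalToricDescent.PoitouTateSelmerStructureDualityFact →
    Summit.BirchSwinnertonDyer.BirchSwinnertonDyer.Theses.UniversalToricDescent.PoitouTateShaTateDualFact →
    ∀ (W' : WeierstrassCurve ℚ) [W'.IsElliptic] [W'.IsGloballyMinimal] (K : Type) [Field K] [NumberField K],
      ¬ Addv W' 3 → IsImaginaryQuadratic K → SplitsIn K 3 →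
      ∀ (κ : ZpExtension K 3), κ.IsAnticyclotomic → ∀ (γ : absoluteGaloisGroup K) [Fact (κ.IsTopGenerator γ)]
      (𝔭 𝔭' : HeightOneSpectrum (𝓞 K)), ((3 : ℕ) : 𝓞 K) ∈ 𝔭.asIdeal → ((3 : ℕ) : 𝓞 K) ∈ 𝔭'.asIdeal → 𝔭 ≠ 𝔭' →
      (∀ m : (W'.baseChange K).geomPrimaryTorsion 3, (∀ σ ∈ κ.kerSubgroup, σ • m = m) → 3 • m = 0 → m = 0) →
      ∀ (S : Set (HeightOneSpectrum (𝓞 K))), S.Finite →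
      (∀ v ∈ S, ((3 : ℕ) : 𝓞 K) ∉ v.asIdeal ∧ ¬ (decomp v ≤ κ.kerSubgroup)) →
      ∀ (v : HeightOneSpectrum (𝓞 K)), ((3 : ℕ) : 𝓞 K) ∉ v.asIdeal → v ∉ S → ¬ (decomp v ≤ κ.kerSubgroup) →
      Set.Finite {s : selmerAc (W'.baseChange K) 3 κ 𝔭' (insert v S) | 3 • s = 0} →
      ∃ C : ℕ, ∀ (k : ℕ) (Φ : Finset (absoluteGaloisGroup K → subgroupH1 (kerD κ v) ((W'.baseChange K).geomPrimaryTorsion 3))),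
        (∀ F ∈ Φ, (∀ (σ h : absoluteGaloisGroup K), h ∈ κ.kerSubgroup → F (σ * h) = F σ) ∧
          (∀ (d : decomp (K := K) v) (σ : absoluteGaloisGroup K), F ((d : absoluteGaloisGroup K) * σ) =
            conjH1 (kerD κ v) ((W'.baseChange K).geomPrimaryTorsion 3) d (F σ)) ∧ 3 ^ k • F = 0) →
        Nat.card {s : selmerAc (W'.baseChange K) 3 κ 𝔭' S // 3 ^ k • s = 0} * Φ.card ≤
          C * Nat.card {s : selmerAc (W'.baseChange K) 3 κ 𝔭' (insert v S) // 3 ^ k • s = 0} := by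
  intro hPT hSha W' _ _ K _ _ h3 hK hsp κ hκ γ _ 𝔭 𝔭' h𝔭 h𝔭' hne htor S hS hSd v hv hvS hvd hfin
  exact stub_countOfRelaxedImage hPT hSha W' K h3 hK hsp κ hκ γ 𝔭 𝔭' h𝔭 h𝔭' hne htor S hS hSd v hv hvS hvd hfin
    (fun v₀ hv₀ hv₀S c d₁ hd₁ hc hdvd ↦
      stub_relaxedImageCount hPT W' K h3 hK hsp κ hκ γ 𝔭 𝔭' h𝔭 h𝔭' hne htor S hS hSd v hv hvS hvd hfin v₀ hv₀ hv₀S c d₁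
        hd₁ hc hdvd (stub_localTorsionCountAtTame W' K κ v hv hvd))

/-- DERIVED TS2′ (v8: no sorry of its own; TS2-TORS = landed p677052, TS2-ASSEMBLY = landed `…StubTwinSigmaSurjOfCount`, TS2-DIV = landed
`…StubLocalH1Divisible` (width utd-p1-w2 g0, 2026-08-29)) — (Σ′), Greenberg–Vatsal Cor. 2.3 FOR THE TWIN, rank-free: for a finitely
decomposed `v ∤ 3`, `v ∉ S`, every right-`ker κ`-invariant left-`D_v`-equivariant `F : Γ_K → H¹(kerD κ v, E′_K[3^∞])` is
the `v`-signature of some `s ∈ Sel_{𝔭′}^{S∪{v}}(K_∞, E′_K[3^∞])`.  From TS2-COUNT + TS2-DIV + TS2-TORS through TS2-ASSEMBLY.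
[cite: GreenbergVatsal2000, §2 Cor. (2.3) (pp. 24–25)] -/
theorem stub_twinSigmaSurj :
    Summit.BirchSwinnertonDyer.BirchSwinnertonDyer.Theses.UniversalToricDescent.PoitouTateSelmerStructureDualityFact →
    Summit.BirchSwinnertonDyer.BirchSwinnertonDyer.Theses.UniversalToricDescent.PoitouTateShaTateDualFact →
    ∀ (W' : WeierstrassCurve ℚ) [W'.IsElliptic] [W'.IsGloballyMinimal] (K : Type) [Field K] [NumberField K],
      ¬ Addv W' 3 → IsImaginaryQuadratic K → SplitsIn K 3 →
      ∀ (κ : ZpExtension K 3), κ.IsAnticyclotomic → ∀ (γ : absoluteGaloisGroup K) [Fact (κ.IsTopGenerator γ)]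
      (𝔭 𝔭' : HeightOneSpectrum (𝓞 K)), ((3 : ℕ) : 𝓞 K) ∈ 𝔭.asIdeal → ((3 : ℕ) : 𝓞 K) ∈ 𝔭'.asIdeal → 𝔭 ≠ 𝔭' →
      (∀ m : (W'.baseChange K).geomPrimaryTorsion 3, (∀ σ ∈ κ.kerSubgroup, σ • m = m) → 3 • m = 0 → m = 0) →
      ∀ (S : Set (HeightOneSpectrum (𝓞 K))), S.Finite →
      (∀ v ∈ S, ((3 : ℕ) : 𝓞 K) ∉ v.asIdeal ∧ ¬ (decomp v ≤ κ.kerSubgroup)) →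
      ∀ (v : HeightOneSpectrum (𝓞 K)), ((3 : ℕ) : 𝓞 K) ∉ v.asIdeal → v ∉ S → ¬ (decomp v ≤ κ.kerSubgroup) →
      Set.Finite {s : selmerAc (W'.baseChange K) 3 κ 𝔭' (insert v S) | 3 • s = 0} →
      ∀ (F : (absoluteGaloisGroup K → subgroupH1 (kerD κ v) ((W'.baseChange K).geomPrimaryTorsion 3))),
      (∀ (σ h : absoluteGaloisGroup K), h ∈ κ.kerSubgroup → F (σ * h) = F σ) →
      (∀ (d : decomp (K := K) v) (σ : absoluteGaloisGroup K), F ((d : absoluteGaloisGroup K) * σ) =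
        conjH1 (kerD κ v) ((W'.baseChange K).geomPrimaryTorsion 3) d (F σ)) →
      ∃ s ∈ selmerAc (W'.baseChange K) 3 κ 𝔭' (insert v S), ∀ σ : absoluteGaloisGroup K,
        resKerD κ ((W'.baseChange K).geomPrimaryTorsion 3) v ((W'.baseChange K).conjH1 3 κ.kerSubgroup σ s) = F σ := by
  intro hPT hSha W' _ _ K _ _ h3 hK hsp κ hκ γ _ 𝔭 𝔭' h𝔭 h𝔭' hne htor S hS hSd v hv hvS hvd hfin F hFH hFD
  exact stub_twinSigmaSurjOfCount hPT hSha W' K h3 hK hsp κ hκ γ 𝔭 𝔭' h𝔭 h𝔭' hne htor S hS hSd v hv hvS hvd hfin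
    (stub_twinSigmaCount hPT hSha W' K h3 hK hsp κ hκ γ 𝔭 𝔭' h𝔭 h𝔭' hne htor S hS hSd v hv hvS hvd hfin)
    (stub_localH1Divisible W' K κ v hv hvd) (stub_twinSignatureTorsion W' K κ v hv hvd) F hFH hFD

/-- DERIVED (no sorry of its own; v4a, g16): **B′≤ = the ONE-SIDED λ-transport for `X_{∅,0}` along `E[3] ≅ E′[3]`,
rank-free** — from TS1′ + TS2′ through the glue G≤ (bad set `Σ_bad`, `3` split from the additive `3 ∣ N` and the Heegner
hypothesis, the conjugate prime, `μ(X_E) = 0` from the wall, `Sel^{Σ_bad}(E)[3]` finite, residual transfer to `E′` (GV Prop. 2.8),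
`E′(K_∞)[3] = 0` from `ρ̄_{E,3}` onto). Statement = v3's B′ with the last conjunct `λ + Σ = λ′ + Σ′` ↦ `λ′ + Σ′ ≤ λ + Σ`.
[cite: GreenbergVatsal2000, Thm. (1.4), §2 Prop. (2.1), (2.4), (2.8), (2.10)] [cite: LeiMullerXia2023, Lemma 3.3, 3.4, Cor. 3.8] -/
theorem oneSidedTransport :
    Summit.BirchSwinnertonDyer.BirchSwinnertonDyer.Theses.UniversalToricDescent.PoitouTateSelmerStructureDualityFact →
    Summit.BirchSwinnertonDyer.BirchSwinnertonDyer.Theses.UniversalToricDescent.PoitouTateShaTateDualFact →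
    ∀ (W : WeierstrassCurve ℚ) [W.IsElliptic] [W.IsGloballyMinimal] (W' : WeierstrassCurve ℚ) [W'.IsElliptic]
      [W'.IsGloballyMinimal] (N N' : ℕ) (K : Type) [Field K] [NumberField K],
      Additive.ClassO6 W 3 → W.HasSurjectiveModNGaloisRep 3 → W.analyticRank = 1 → W.conductorNorm ℤ = N →
      O6.ModPCongruent W' W 3 → ¬ Addv W' 3 → W'.conductorNorm ℤ = N' → IsImaginaryQuadratic K →
      SatisfiesHeegnerHypothesis N K → SatisfiesHeegnerHypothesis N' K →
      (∀ v : HeightOneSpectrum (𝓞 K), ((3 : ℕ) : 𝓞 K) ∈ v.asIdeal → Finite (selmerAcBase (W.baseChange K) 3 v ∅)) →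
      ∀ (κ : ZpExtension K 3), κ.IsAnticyclotomic → ∀ (γ : absoluteGaloisGroup K) [Fact (κ.IsTopGenerator γ)]
      (𝔭' : HeightOneSpectrum (𝓞 K)), ((3 : ℕ) : 𝓞 K) ∈ 𝔭'.asIdeal →
      Module.IsTorsion (IwasawaAlgebra 3) (XAc (W.baseChange K) 3 κ 𝔭' ∅ γ) →
      ∀ (L : UnrSeries 3), Ideal.span {L} ≤
        (XAc.charIdeal (W.baseChange K) 3 κ 𝔭' ∅ γ).map (PowerSeries.map (Halves.toUnr 3)) →
      (∃ i : ℕ, ‖((PowerSeries.coeff i L : unrIntegers 3) : ℂ_[3])‖ = 1) →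
      ∃ (T : Finset (HeightOneSpectrum (𝓞 K))) (c s s' : HeightOneSpectrum (𝓞 K) → ℕ),
        (↑T = {v : HeightOneSpectrum (𝓞 K) | ((3 : ℕ) : 𝓞 K) ∉ v.asIdeal ∧
          (¬ (W.baseChange K).HasGoodReductionAt v ∨ ¬ (W'.baseChange K).HasGoodReductionAt v)}) ∧
        (∀ v ∈ T, (∃ d₀ : decomp (K := K) v, (κ (d₀ : absoluteGaloisGroup K)).toAdd = (3 : ℤ_[3]) ^ c v) ∧
          (∀ d : decomp (K := K) v, (3 : ℤ_[3]) ^ c v ∣ (κ (d : absoluteGaloisGroup K)).toAdd) ∧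
          Nat.card {f : subgroupH1 (kerD κ v) ((W.baseChange K).geomPrimaryTorsion 3) // 3 • f = 0} = 3 ^ s v ∧
          Nat.card {f : subgroupH1 (kerD κ v) ((W'.baseChange K).geomPrimaryTorsion 3) // 3 • f = 0} = 3 ^ s' v) ∧
        (∃ g : UnrSeries 3,
          (XAc.charIdeal (W.baseChange K) 3 κ 𝔭' ∅ γ).map (PowerSeries.map (Halves.toUnr 3)) = Ideal.span {g} ∧
            (∀ i < lambdaInvariant 3 (XAc (W.baseChange K) 3 κ 𝔭' ∅ γ),
              ‖((PowerSeries.coeff i g : unrIntegers 3) : ℂ_[3])‖ < 1) ∧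
            ‖((PowerSeries.coeff (lambdaInvariant 3 (XAc (W.baseChange K) 3 κ 𝔭' ∅ γ)) g :
              unrIntegers 3) : ℂ_[3])‖ = 1) ∧
        Module.IsTorsion (IwasawaAlgebra 3) (XAc (W'.baseChange K) 3 κ 𝔭' ∅ γ) ∧
        (∃ g' : UnrSeries 3,
          (XAc.charIdeal (W'.baseChange K) 3 κ 𝔭' ∅ γ).map (PowerSeries.map (Halves.toUnr 3)) = Ideal.span {g'} ∧
            (∀ i < lambdaInvariant 3 (XAc (W'.baseChange K) 3 κ 𝔭' ∅ γ),
              ‖((PowerSeries.coeff i g' : unrIntegers 3) : ℂ_[3])‖ < 1) ∧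
            ‖((PowerSeries.coeff (lambdaInvariant 3 (XAc (W'.baseChange K) 3 κ 𝔭' ∅ γ)) g' :
              unrIntegers 3) : ℂ_[3])‖ = 1) ∧
        lambdaInvariant 3 (XAc (W'.baseChange K) 3 κ 𝔭' ∅ γ) + ∑ v ∈ T, 3 ^ c v * s' v ≤
          lambdaInvariant 3 (XAc (W.baseChange K) 3 κ 𝔭' ∅ γ) + ∑ v ∈ T, 3 ^ c v * s v := by
  intro hPT hPT2 W _ _ W' _ _ N N' K _ _ hO6 hsurj _hr hN hcong hadd' hN' hK hHe hHe' hfin κ hκ γ _ 𝔭' h𝔭' hT L hle hi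
  haveI : Fact (Nat.Prime 3) := ⟨Nat.prime_three⟩
  -- the bad set `Σ_bad`
  set S : Set (HeightOneSpectrum (𝓞 K)) := {v | ((3 : ℕ) : 𝓞 K) ∉ v.asIdeal ∧
    (¬ (W.baseChange K).HasGoodReductionAt v ∨ ¬ (W'.baseChange K).HasGoodReductionAt v)} with hSdef
  have hSfin : S.Finite := by
    refine (((W.baseChange K).finite_badPlaces_holds (𝓞 K)).union
      ((W'.baseChange K).finite_badPlaces_holds (𝓞 K))).subset fun v hv ↦ ?_
    rcases hv.2 with h | h
    · exact Or.inl h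
    · exact Or.inr h
  have hSp : ∀ v ∈ S, ((3 : ℕ) : 𝓞 K) ∉ v.asIdeal := fun v hv ↦ hv.1
  have hSdec : ∀ v ∈ S, ¬ (decomp v ≤ κ.kerSubgroup) := by
    intro v hv
    rcases hv.2 with h | h
    · exact UniversalToricDescentTorsionMuTransportHeegner.not_decomp_le_kerSubgroup_of_not_hasGoodReductionAt_baseChange
        W hN K hK hHe (by decide) κ hκ hv.1 h
    · exact UniversalToricDescentTorsionMuTransportHeegner.not_decomp_le_kerSubgroup_of_not_hasGoodReductionAt_baseChange
        W' hN' K hK hHe' (by decide) κ hκ hv.1 h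
  have hnice : ∀ S' ⊆ S, ∀ v ∈ S', ((3 : ℕ) : 𝓞 K) ∉ v.asIdeal ∧ ¬ (decomp v ≤ κ.kerSubgroup) :=
    fun S' hS' v hv ↦ ⟨hSp v (hS' hv), hSdec v (hS' hv)⟩
  have hgood : ∀ v : HeightOneSpectrum (𝓞 K), v ∉ S → ((3 : ℕ) : 𝓞 K) ∉ v.asIdeal →
      (W.baseChange K).HasGoodReductionAt v := fun v hv hpv ↦ by
    by_contra h; exact hv ⟨hpv, Or.inl h⟩
  have hgood' : ∀ v : HeightOneSpectrum (𝓞 K), v ∉ S → ((3 : ℕ) : 𝓞 K) ∉ v.asIdeal →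
      (W'.baseChange K).HasGoodReductionAt v := fun v hv hpv ↦ by
    by_contra h; exact hv ⟨hpv, Or.inr h⟩
  -- `3` splits in `K`; the conjugate prime `𝔭 ≠ 𝔭′`
  have hadd : Addv W 3 := hO6.2.1
  have hpN : 3 ∣ W.conductorNorm ℤ := (W.dvd_conductorNorm_iff_not_hasGoodReductionAtPrime 3).mpr hadd.1
  have hsplit : SplitsIn K 3 := hHe 3 (Fact.out) (hN ▸ hpN)
  obtain ⟨-, 𝔭, -, hne, h𝔭, -⟩ := LocalIndexTransport.exists_conj_prime_of_splitsIn K 3 hK.1 hsplit h𝔭'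
  -- `Sel_{𝔭′}^{S′}(E′)[3]` finite on `S′ ⊆ Σ_bad`: `μ(X_E) = 0` from the wall, up to `Σ_bad`, residual transfer to `E′`
  haveI := XAc.module_finite κ 𝔭' (∅ : Set (HeightOneSpectrum (𝓞 K))) γ Set.finite_empty (W := W.baseChange K)
  have hμe : muInvariant 3 (XAc (W.baseChange K) 3 κ 𝔭' ∅ γ) = 0 :=
    muInvariant_eq_zero_of_span_le_map_charIdeal (XAc (W.baseChange K) 3 κ 𝔭' ∅ γ) hT hle hi
  have hfine : Set.Finite {s : selmerAc (W.baseChange K) 3 κ 𝔭' ∅ | 3 • s = 0} :=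
    finite_pTorsion_of_muInvariant_eq_zero (W.baseChange K) 3 κ 𝔭' ∅ γ hT hμe
  have hfinS : Set.Finite {s : selmerAc (W.baseChange K) 3 κ 𝔭' S | 3 • s = 0} :=
    finite_selmerAc_pTorsion_of_empty (W.baseChange K) κ hSfin hSp hSdec hfine
  have h𝔭'dec : ¬ (decomp 𝔭' ≤ κ.kerSubgroup) :=
    ZpExtension.decomp_not_le_kerSubgroup_above_of_isAnticyclotomic_holds K 3 hK (by decide) κ hκ 𝔭' h𝔭'
  obtain ⟨e, he⟩ :=
    UniversalToricDescentResidualSelmerTransfer.exists_torsionIso_baseChange_of_modPCongruent (K := K) W W' hcong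
  have hes : ∀ (σ : absoluteGaloisGroup K) (P : (W.baseChange K).geomTorsion (3 : ℤ)),
      e.symm (σ • P) = σ • e.symm P := fun σ P ↦ by
    apply e.injective; rw [e.apply_symm_apply, he, e.apply_symm_apply]
  have hfinS' : Set.Finite {s : selmerAc (W'.baseChange K) 3 κ 𝔭' S | 3 • s = 0} :=
    UniversalToricDescentResidualSelmerTransfer.finite_selmerAc_pTorsion_transfer_of_torsionIso κ (W.baseChange K)
      (W'.baseChange K) (by decide) h𝔭' h𝔭'dec hgood hgood' e.symm hes hfinS
  have hfin𝔭' : ∀ S' ⊆ S, Set.Finite {s : selmerAc (W'.baseChange K) 3 κ 𝔭' S' | 3 • s = 0} :=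
    fun S' hS' ↦ finite_selmerAc_pTorsion_of_subset (W'.baseChange K) 3 κ hS' hfinS'
  -- `E′(K_∞)[3] = 0`
  have hG : ∀ m : (W.baseChange K).geomPrimaryTorsion 3, (∀ σ ∈ κ.kerSubgroup, σ • m = m) → 3 • m = 0 → m = 0 := by
    intro m hm _
    have hmem : m ∈ FixedPoints.addSubgroup κ.kerSubgroup (geomPrimaryTorsion (W.baseChange K) 3) := fun g ↦ hm g g.2
    rw [UniversalToricDescentTowerTorsion.fixedPoints_kerSubgroup_geomPrimaryTorsion_baseChange_eq_bot_of_surjective W 3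
      hsurj K hK κ] at hmem
    exact (AddSubgroup.mem_bot).mp hmem
  have hG' : ∀ m : (W'.baseChange K).geomPrimaryTorsion 3, (∀ σ ∈ κ.kerSubgroup, σ • m = m) → 3 • m = 0 → m = 0 :=
    UniversalToricDescentResidualSelmerExact.noFixedPTorsion_of_torsionIso (W.baseChange K) (W'.baseChange K)
      κ.kerSubgroup e.symm hes hG
  -- the two tower statements about the twin on the subsets of `Σ_bad`, through the LANDED one-sided glue G≤
  refine stub_oneSidedGlue W W' K hO6 hsurj hN hcong hadd' hN' hK hHe hHe' κ hκ γ h𝔭' hT hle hi (hPT K) (hPT2 K) hfin ?_ ?_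
  · intro S₁ hS₁ v₀ hv₀ hv₀S F hFH hFD
    have hsub : S₁ ⊆ S := hS₁ ▸ subset_rfl
    exact stub_twinStrictSurj hPT hPT2 W' K hadd' hK hsplit κ hκ γ 𝔭 𝔭' h𝔭 h𝔭' hne hG' S₁ (hSfin.subset hsub)
      (hnice S₁ hsub) (hfin𝔭' S₁ hsub) v₀ hv₀ hv₀S F hFH hFD
  · intro S₁ hS₁ v hpv hbad hvS hvdec F hFH hFD
    have hsub : insert v S₁ ⊆ S := Set.insert_subset ⟨hpv, hbad⟩ hS₁
    exact stub_twinSigmaSurj hPT hPT2 W' K hadd' hK hsplit κ hκ γ 𝔭 𝔭' h𝔭 h𝔭' hne hG' S₁ (hSfin.subset hS₁)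
      (hnice S₁ hS₁) v hpv hvS hvdec (hfin𝔭' _ hsub) F hFH hFD

/-- **COMPOSITION (no sorry of its own): A + B′≤ give ♭T≤ BY NAME.** `intro` ♭T≤'s binders; `μ(𝓛′) = 0` is ♭T≤'s
per-frame hypothesis `hi′`; `μ(𝓛) = 0` follows from stub A at the bad set (`exists_normProfile_of_sigmaCongruence`); B′≤
(derived), fed ♭T≤'s Poitou–Tate facts and the wild curve's base finiteness, gives the algebraic data and
`λ_alg(E′) + Σ′ ≤ λ_alg(E) + Σ`; stub A at B′≤'s `(T, c)` gives the analytic identity `m + Σ = m′ + Σ′`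
(`analyticIdentity_of_sigmaCongruence`); `n′ + m ≤ n + m′` by cancellation. [cite: GreenbergVatsal2000, Thm. (1.4) and (1.5)] -/
theorem DefectTransportModThreePT_of :
    Summit.BirchSwinnertonDyer.BirchSwinnertonDyer.Theses.UniversalToricDescent.DefectTransportModThreePT := by
  intro hPT hPT2 W _ _ W' _ _ N N' _ _ K _ _ Dt Dt' hO6 hsurj hr hN hcong hadd hN' hK hHe hHe' hfinE κ hκ γ _ 𝔭 𝔭' h𝔭 he
    hf h𝔭' hne ι' hbr hT ΩK Ωp L hΩK hΩp hL hle ΩK' Ωp' L' hΩK' hΩp' hL' hi'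
  haveI : Fact (Nat.Prime 3) := ⟨Nat.prime_three⟩
  -- A at `(𝓛, 𝓛′)`
  have hAL := stub_sigmaCongruence W W' N N' K Dt Dt' hO6 hsurj hr hN hcong hadd hN' hK hHe hHe' κ hκ γ 𝔭 h𝔭 he hf
    𝔭' h𝔭' hne ι' hbr ΩK Ωp L hΩK hΩp hL ΩK' Ωp' L' hΩK' hΩp' hL'
  -- `μ(𝓛) = 0`: instantiate A at the finite bad set with its exact indices
  set S : Set (HeightOneSpectrum (𝓞 K)) := {v | ((3 : ℕ) : 𝓞 K) ∉ v.asIdeal ∧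
    (¬ (W.baseChange K).HasGoodReductionAt v ∨ ¬ (W'.baseChange K).HasGoodReductionAt v)} with hSdef
  have hSfin : S.Finite := by
    refine (((W.baseChange K).finite_badPlaces_holds (𝓞 K)).union
      ((W'.baseChange K).finite_badPlaces_holds (𝓞 K))).subset fun v hv ↦ ?_
    rcases hv.2 with h | h
    · exact Or.inl h
    · exact Or.inr h
  have hSdec : ∀ v ∈ S, ¬ (decomp v ≤ κ.kerSubgroup) := by
    intro v hv
    rcases hv.2 with h | h
    · exact UniversalToricDescentTorsionMuTransportHeegner.not_decomp_le_kerSubgroup_of_not_hasGoodReductionAt_baseChange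
        W hN K hK hHe (by decide) κ hκ hv.1 h
    · exact UniversalToricDescentTorsionMuTransportHeegner.not_decomp_le_kerSubgroup_of_not_hasGoodReductionAt_baseChange
        W' hN' K hK hHe' (by decide) κ hκ hv.1 h
  choose! c₀ hc₀ using fun v (hv : v ∈ hSfin.toFinset) ↦
    UniversalToricDescentSigmaLocalStabilizer.exists_pow_and_forall_dvd_of_not_le κ v
      (hSdec v (hSfin.mem_toFinset.mp hv))
  obtain ⟨e₀, u₀, hu₀, he₀, hcong₀⟩ := hAL hSfin.toFinset c₀ (by rw [Set.Finite.coe_toFinset])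
    (fun v hv ↦ ⟨(hc₀ v hv).1, (hc₀ v hv).2.2⟩)
  have hi : ∃ i : ℕ, ‖((PowerSeries.coeff i L : unrIntegers 3) : ℂ_[3])‖ = 1 := by
    obtain ⟨m, -, hm, -, -⟩ := exists_normProfile_of_sigmaCongruence (W.baseChange K) (W'.baseChange K)
      hSfin.toFinset (fun v hv ↦ (hSfin.mem_toFinset.mp hv).1) e₀ (fun v hv ↦ (he₀ v hv).1) hi' hu₀ hcong₀
    exact ⟨m, hm.2⟩
  -- B′
  obtain ⟨T, c, s, s', hTS, hdata, ⟨g, hg, hglt, hgeq⟩, hT', ⟨g', hg', hglt', hgeq'⟩, hsum⟩ :=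
    oneSidedTransport hPT hPT2 W W' N N' K hO6 hsurj hr hN hcong hadd hN' hK hHe hHe' hfinE κ hκ γ 𝔭' h𝔭' hT L
      hle hi
  have hTp : ∀ v ∈ T, ((3 : ℕ) : 𝓞 K) ∉ v.asIdeal := fun v hv ↦ by
    have h : v ∈ (↑T : Set (HeightOneSpectrum (𝓞 K))) := Finset.mem_coe.mpr hv
    rw [hTS] at h
    exact h.1
  -- A at B′'s data, then the analytic identity
  obtain ⟨e, u, hu, he', hcongT⟩ := hAL T c hTS (fun v hv ↦ ⟨(hdata v hv).1, (hdata v hv).2.1⟩)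
  obtain ⟨m, m', hm, hm', hsum'⟩ :=
    analyticIdentity_of_sigmaCongruence W W' K κ T c s s' hTp hdata e he' hi' hu hcongT
  exact ⟨g, g', _, m, _, m', hg, hg', ⟨hglt, hgeq⟩, hm, ⟨hglt', hgeq'⟩, hm', by omega⟩

end Summit.BirchSwinnertonDyer.BirchSwinnertonDyer.Cruxes.DefectTransportModThreePT.SigmaCongruence

end
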